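import Summits.MatrixMultiplication.OmegaCensus.STPPVosperSlackOneLawMult

/-!
# ω-census (abelian STPP census): tools for the Vosper TILING law — dilations, and the exact-cover checker with its soundness (kernel)

HONEST FRAMING (pub-omega census; verbatim): lottery ticket; floor = certified bounds/negative ranges.
Census STRUCTURE (seat pub-omega-stpp-1 gen 30, 2026-08-28), family (b2).  At an N18-TIGHT block `i` of an STPP family in `ℤ/pℤ` Vosper's theorem makes
`Y° = ⋃_{k≠i}(C_k − B_k)` an `L`-term progression of step `e` and `Z° = ⋃_{k≠i}(C_k − A_k)` a `z`-term progression of step `e′`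
(`vosper_structure_of_n18_tight`).  The difference sets `C_k − B_k`, `C_k − A_k` of the OTHER blocks therefore PARTITION these two progressions; after
normalisation (dilation `e′ ↦ 1`, row shifts, one translation per block — `IsSTPP` depends only on per-block difference sets) this is a finite exact-cover
problem.  This file provides the normalisation tool (`isSTPP_dilate`) and the exact-cover CHECKER `existsCover` with its SOUNDNESS
(`existsCover_of_blocks`): if sets `(A_k, B_k, C_k)` with `0 ∈ B_k`, `C_k − B_k ⊆ Y-points`, `C_k − A_k ⊆ Z-points`, distinct differences, pairwise disjoint
difference sets covering the Y- and Z-point lists exist, the checker returns `true`.  So `existsCover … = false` (decided by the kernel) excludes them.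
UNCONDITIONAL (no Hamidoune–Rødseth).  Nothing here is progress on `ω`.

References: A. G. Vosper, J. London Math. Soc. 31 (1956); M. B. Nathanson, GTM 165, Thm 2.7; H. Cohn, R. Kleinberg, B. Szegedy, C. Umans, FOCS 2005
(arXiv:math/0511460), Def. 5.1.
-/

open Finset
open scoped Pointwise

namespace Summit.MatrixMultiplication.OmegaCensus.CubeNB

open Literature.Computability.AlgebraicComplexity
open Literature.Combinatorics.Additive
open Summit.MatrixMultiplication.OmegaCensus.STPPKneser

/-! ## §1 Dilations -/

section Dilate

variable {p : ℕ} [hp : Fact p.Prime] {N : ℕ} {A B C : Fin N → Finset (ZMod p)}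

/-- Multiplying every set of every triple by a unit `u` preserves the STPP (the Def. 5.1 word is multiplied by `u`).
[cite: CohnKleinbergSzegedyUmans2005, Def. 5.1] -/
theorem isSTPP_dilate (hS : IsSTPP A B C) {u : ZMod p} (hu : u ≠ 0) :
    IsSTPP (fun t => (A t).image (u * ·)) (fun t => (B t).image (u * ·)) (fun t => (C t).image (u * ·)) := by
  intro i j k s hs s' hs' t ht t' ht' v hv v' hv' h0
  simp only [Finset.mem_image] at hs hs' ht ht' hv hv'
  obtain ⟨s, hs, rfl⟩ := hs
  obtain ⟨s', hs', rfl⟩ := hs'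
  obtain ⟨t, ht, rfl⟩ := ht
  obtain ⟨t', ht', rfl⟩ := ht'
  obtain ⟨v, hv, rfl⟩ := hv
  obtain ⟨v', hv', rfl⟩ := hv'
  have h0' : (s' - s) + (t' - t) + (v' - v) = 0 := by
    have h1 : u * ((s' - s) + (t' - t) + (v' - v)) = 0 := by rw [← h0]; ring
    rcases mul_eq_zero.1 h1 with h | h
    · exact absurd h hu
    · exact h
  obtain ⟨hij, hjk, e1, e2, e3⟩ := hS i j k s hs s' hs' t ht t' ht' v hv v' hv' h0'
  exact ⟨hij, hjk, by rw [e1], by rw [e2], by rw [e3]⟩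

end Dilate

/-! ## §2 The exact-cover checker -/

section Cover

/-- Differences of two lists modulo `p`: `[(c + p − x) mod p | c ← C, x ← X]`. [folklore] -/
def diffList (p : ℕ) (C X : List ℕ) : List ℕ := (C ×ˢ X).map fun cx => (cx.1 + p - cx.2) % p

/-- Residues `x < p` such that `(c − x) mod p` passes `ok` for every `c ∈ C`. [folklore] -/
def candShift (p : ℕ) (C : List ℕ) (ok : ℕ → Bool) : List ℕ := (List.range p).filter fun x => C.all fun c => ok ((c + p - x) % p)

/-- Candidate difference data of ONE block of sizes `(a, b, c)`: all `(Y_k, Z_k) = (C − B, C − A)` (as lists of residues) with `C` a `c`-sublist of the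
Y-points `YL`, `B = 0 :: B'` with `C − B ⊆ Y-points`, `A` with `C − A ⊆ [0, z)` (the Z-points), all three difference lists `C − B`, `C − A`, `A − B`
duplicate-free. [folklore] -/
def blockDiffs (p z : ℕ) (YL : List ℕ) (a b c : ℕ) : List (List ℕ × List ℕ) :=
  (YL.sublistsLen c).flatMap fun C =>
    (((candShift p C fun y => decide (y ∈ YL)).filter fun x => x != 0).sublistsLen (b - 1)).flatMap fun B' =>
      ((candShift p C fun t => decide (t < z)).sublistsLen a).filterMap fun A =>
        if (diffList p C (0 :: B')).Nodup && (diffList p C A).Nodup && (diffList p A (0 :: B')).Nodup then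
          some (diffList p C (0 :: B'), diffList p C A) else none

/-- **Exact-cover search.**  `existsCover p z YL blocks uY uZ`: can the blocks (sizes `(a,b,c)`, in order) be realised with difference data from
`blockDiffs`, disjoint from the already used residues `uY`, `uZ` (and, recursively, from each other), so that finally every Y-point is in `uY` and every
`t < z` in `uZ`? [folklore] -/
def existsCover (p z : ℕ) (YL : List ℕ) : List (ℕ × ℕ × ℕ) → List ℕ → List ℕ → Bool
  | [], uY, uZ => (YL.all fun y => decide (y ∈ uY)) && ((List.range z).all fun t => decide (t ∈ uZ))
  | (a, b, c) :: rest, uY, uZ =>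
    (blockDiffs p z YL a b c).any fun YZ =>
      (YZ.1.all fun y => !(decide (y ∈ uY))) && (YZ.2.all fun t => !(decide (t ∈ uZ))) && existsCover p z YL rest (YZ.1 ++ uY) (YZ.2 ++ uZ)

end Cover

/-! ## §3 Soundness of the checker -/

section Sound

/-- For a duplicate-free list `l` and a finset `S` of its elements, `l.filter (· ∈ S)` has `#S` elements. [folklore] -/
theorem length_filter_mem_of_subset {l : List ℕ} (hl : l.Nodup) {S : Finset ℕ} (hS : ∀ x ∈ S, x ∈ l) :
    (l.filter fun x => decide (x ∈ S)).length = #S := by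
  have hnd : (l.filter fun x => decide (x ∈ S)).Nodup := hl.filter _
  rw [← List.toFinset_card_of_nodup hnd]
  congr 1
  ext x
  simp only [List.mem_toFinset, List.mem_filter, decide_eq_true_eq]
  exact ⟨fun h => h.2, fun h => ⟨hS x h, h⟩⟩

/-- Values of differences in `ℤ/pℤ`: `(c − x).val = (c.val + p − x.val) mod p`. [folklore] -/
theorem val_sub_eq_mod {p : ℕ} [Fact p.Prime] (c x : ZMod p) : (c - x).val = (c.val + p - x.val) % p := by
  have hx := ZMod.val_lt x
  by_cases h0 : x = 0
  · rw [h0, sub_zero, ZMod.val_zero, Nat.sub_zero, Nat.add_mod_right, Nat.mod_eq_of_lt (ZMod.val_lt c)]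
  · rw [sub_eq_add_neg, ZMod.val_add, ZMod.neg_val, if_neg h0, show c.val + (p - x.val) = c.val + p - x.val by omega]

/-- Membership in `diffList`. [folklore] -/
theorem mem_diffList {p : ℕ} {C X : List ℕ} {y : ℕ} : y ∈ diffList p C X ↔ ∃ c ∈ C, ∃ x ∈ X, (c + p - x) % p = y := by
  simp only [diffList, List.mem_map, List.mem_product, Prod.exists]
  constructor
  · rintro ⟨c, x, ⟨hc, hx⟩, h⟩; exact ⟨c, hc, x, hx, h⟩
  · rintro ⟨c, hc, x, hx, h⟩; exact ⟨c, x, ⟨hc, hx⟩, h⟩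

/-- Membership in `candShift`. [folklore] -/
theorem mem_candShift {p : ℕ} {C : List ℕ} {ok : ℕ → Bool} {x : ℕ} : x ∈ candShift p C ok ↔ x < p ∧ ∀ c ∈ C, ok ((c + p - x) % p) = true := by
  simp only [candShift, List.mem_filter, List.mem_range, List.all_eq_true]

/-- `diffList` is duplicate-free when the lists are and the difference map is injective on their product. [folklore] -/
theorem nodup_diffList {p : ℕ} {C X : List ℕ} (hC : C.Nodup) (hX : X.Nodup)
    (hinj : ∀ c ∈ C, ∀ c' ∈ C, ∀ x ∈ X, ∀ x' ∈ X, (c + p - x) % p = (c' + p - x') % p → c = c' ∧ x = x') :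
    (diffList p C X).Nodup := by
  rw [diffList]
  refine List.Nodup.map_on ?_ (hC.product hX)
  rintro ⟨c, x⟩ hcx ⟨c', x'⟩ hcx' h
  rw [List.mem_product] at hcx hcx'
  obtain ⟨h1, h2⟩ := hinj c hcx.1 c' hcx'.1 x hcx.2 x' hcx'.2 h
  rw [h1, h2]

/-- Membership in `blockDiffs` (the witnesses spelled out). [folklore] -/
theorem mem_blockDiffs {p z : ℕ} {YL : List ℕ} {a b c : ℕ} {C B' A : List ℕ}
    (hC : C ∈ YL.sublistsLen c) (hB : B' ∈ ((candShift p C fun y => decide (y ∈ YL)).filter fun x => x != 0).sublistsLen (b - 1))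
    (hA : A ∈ (candShift p C fun t => decide (t < z)).sublistsLen a)
    (h1 : (diffList p C (0 :: B')).Nodup) (h2 : (diffList p C A).Nodup) (h3 : (diffList p A (0 :: B')).Nodup) :
    (diffList p C (0 :: B'), diffList p C A) ∈ blockDiffs p z YL a b c := by
  rw [blockDiffs, List.mem_flatMap]
  refine ⟨C, hC, ?_⟩
  rw [List.mem_flatMap]
  refine ⟨B', hB, ?_⟩
  rw [List.mem_filterMap]
  refine ⟨A, hA, ?_⟩
  simp [h1, h2, h3]

variable {ι : Type*}

/-- **Soundness of the exact-cover checker.**  Blocks `k ∈ ks` (duplicate-free, all `good`) with value sets `Av k, Bv k, Cv k ⊆ [0, p)` of sizes `sz k = (a,b,c)`,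
`0 ∈ Bv k`, all differences `(c − x) mod p` (`c ∈ Cv k`, `x ∈ Bv k`) among the Y-points `YL` (duplicate-free), all `(c − x) mod p`
(`x ∈ Av k`) below `z`, the three difference maps injective, the Y-difference sets pairwise disjoint and disjoint from `uY` and together with `uY`
covering `YL` (likewise `Z` with `[0, z)`): then `existsCover p z YL (ks.map sz) uY uZ = true`. [folklore] -/
theorem existsCover_complete {p z : ℕ} {YL : List ℕ} (hYL : YL.Nodup) (good : ι → Prop)
    (sz : ι → ℕ × ℕ × ℕ) (Av Bv Cv : ι → Finset ℕ)
    (hszA : ∀ k, good k → #(Av k) = (sz k).1) (hszB : ∀ k, good k → #(Bv k) = (sz k).2.1) (hszC : ∀ k, good k → #(Cv k) = (sz k).2.2)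
    (hAp : ∀ k, ∀ x ∈ Av k, x < p) (hBp : ∀ k, ∀ x ∈ Bv k, x < p) (hCp : ∀ k, ∀ x ∈ Cv k, x < p) (hB0 : ∀ k, good k → 0 ∈ Bv k)
    (hY : ∀ k, good k → ∀ c ∈ Cv k, ∀ x ∈ Bv k, (c + p - x) % p ∈ YL) (hZ : ∀ k, good k → ∀ c ∈ Cv k, ∀ x ∈ Av k, (c + p - x) % p < z)
    (hinjY : ∀ k, good k → ∀ c ∈ Cv k, ∀ c' ∈ Cv k, ∀ x ∈ Bv k, ∀ x' ∈ Bv k, (c + p - x) % p = (c' + p - x') % p → c = c' ∧ x = x')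
    (hinjZ : ∀ k, good k → ∀ c ∈ Cv k, ∀ c' ∈ Cv k, ∀ x ∈ Av k, ∀ x' ∈ Av k, (c + p - x) % p = (c' + p - x') % p → c = c' ∧ x = x')
    (hinjX : ∀ k, good k → ∀ c ∈ Av k, ∀ c' ∈ Av k, ∀ x ∈ Bv k, ∀ x' ∈ Bv k, (c + p - x) % p = (c' + p - x') % p → c = c' ∧ x = x') :
    ∀ (ks : List ι), ks.Nodup → (∀ k ∈ ks, good k) → ∀ (uY uZ : List ℕ),
      (∀ k ∈ ks, ∀ c ∈ Cv k, ∀ x ∈ Bv k, (c + p - x) % p ∉ uY) →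
      (∀ k ∈ ks, ∀ k' ∈ ks, k ≠ k' → ∀ c ∈ Cv k, ∀ x ∈ Bv k, ∀ c' ∈ Cv k', ∀ x' ∈ Bv k', (c + p - x) % p ≠ (c' + p - x') % p) →
      (∀ y ∈ YL, y ∈ uY ∨ ∃ k ∈ ks, ∃ c ∈ Cv k, ∃ x ∈ Bv k, (c + p - x) % p = y) →
      (∀ k ∈ ks, ∀ c ∈ Cv k, ∀ x ∈ Av k, (c + p - x) % p ∉ uZ) →
      (∀ k ∈ ks, ∀ k' ∈ ks, k ≠ k' → ∀ c ∈ Cv k, ∀ x ∈ Av k, ∀ c' ∈ Cv k', ∀ x' ∈ Av k', (c + p - x) % p ≠ (c' + p - x') % p) →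
      (∀ t < z, t ∈ uZ ∨ ∃ k ∈ ks, ∃ c ∈ Cv k, ∃ x ∈ Av k, (c + p - x) % p = t) →
      existsCover p z YL (ks.map sz) uY uZ = true := by
  intro ks
  induction ks with
  | nil =>
    intro _ _ uY uZ _ _ hcovY _ _ hcovZ
    rw [List.map_nil, existsCover, Bool.and_eq_true, List.all_eq_true, List.all_eq_true]
    constructor
    · intro y hy
      rw [decide_eq_true_eq]
      rcases hcovY y hy with h | ⟨k, hk, -⟩
      · exact h
      · simp at hk
    · intro t ht
      rw [decide_eq_true_eq]
      rcases hcovZ t (List.mem_range.1 ht) with h | ⟨k, hk, -⟩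
      · exact h
      · simp at hk
  | cons k rest ih =>
    intro hnd hgood uY uZ huY hdisjY hcovY huZ hdisjZ hcovZ
    rw [List.nodup_cons] at hnd
    obtain ⟨hkrest, hndrest⟩ := hnd
    have hgk : good k := hgood k (by simp)
    have hgrest : ∀ k' ∈ rest, good k' := fun k' hk' => hgood k' (by simp [hk'])
    rcases hsz : sz k with ⟨a, b, c⟩
    have hca : #(Av k) = a := by simp [hszA k hgk, hsz]
    have hcb : #(Bv k) = b := by simp [hszB k hgk, hsz]
    have hcc : #(Cv k) = c := by simp [hszC k hgk, hsz]
    rw [List.map_cons, hsz, existsCover, List.any_eq_true]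
    -- the lists realising block k
    have hCsub : ∀ x ∈ Cv k, x ∈ YL := by
      intro x hx
      have h := hY k hgk x hx 0 (hB0 k hgk)
      rwa [Nat.sub_zero, Nat.add_mod_right, Nat.mod_eq_of_lt (hCp k x hx)] at h
    set Cl := YL.filter (fun x => decide (x ∈ Cv k)) with hCl
    set candB := (candShift p Cl fun y => decide (y ∈ YL)).filter (fun x => x != 0) with hcandB
    set Bl := candB.filter (fun x => decide (x ∈ (Bv k).erase 0)) with hBl
    set candA := candShift p Cl (fun t => decide (t < z)) with hcandA
    set Al := candA.filter (fun x => decide (x ∈ Av k)) with hAl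
    have hClmem : ∀ x, x ∈ Cl ↔ x ∈ Cv k := by
      intro x; rw [hCl, List.mem_filter, decide_eq_true_eq]; exact ⟨fun h => h.2, fun h => ⟨hCsub x h, h⟩⟩
    have hClnd : Cl.Nodup := hYL.filter _
    have hCllen : Cl.length = c := by rw [hCl, length_filter_mem_of_subset hYL hCsub, hcc]
    have hBsub : ∀ x ∈ (Bv k).erase 0, x ∈ candB := by
      intro x hx
      rw [Finset.mem_erase] at hx
      rw [hcandB, List.mem_filter, mem_candShift]
      refine ⟨⟨hBp k x hx.2, fun c' hc' => ?_⟩, by simpa using hx.1⟩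
      rw [decide_eq_true_eq]
      exact hY k hgk c' ((hClmem c').1 hc') x hx.2
    have hcandBnd : candB.Nodup := ((List.nodup_range).filter _).filter _
    have hBlmem : ∀ x, x ∈ Bl ↔ x ∈ (Bv k).erase 0 := by
      intro x; rw [hBl, List.mem_filter, decide_eq_true_eq]; exact ⟨fun h => h.2, fun h => ⟨hBsub x h, h⟩⟩
    have hBlnd : Bl.Nodup := hcandBnd.filter _
    have hBllen : Bl.length = b - 1 := by
      rw [hBl, length_filter_mem_of_subset hcandBnd hBsub, Finset.card_erase_of_mem (hB0 k hgk), hcb]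
    have hB0l : ∀ x, x ∈ (0 :: Bl) ↔ x ∈ Bv k := by
      intro x; rw [List.mem_cons, hBlmem, Finset.mem_erase]
      constructor
      · rintro (rfl | ⟨-, h⟩); exacts [hB0 k hgk, h]
      · intro h; by_cases h0 : x = 0; exacts [Or.inl h0, Or.inr ⟨h0, h⟩]
    have hB0nd : (0 :: Bl).Nodup := by
      rw [List.nodup_cons]; refine ⟨fun h => ?_, hBlnd⟩
      have := (hBlmem 0).1 h; simp at this
    have hAsub : ∀ x ∈ Av k, x ∈ candA := by
      intro x hx
      rw [hcandA, mem_candShift]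
      refine ⟨hAp k x hx, fun c' hc' => ?_⟩
      rw [decide_eq_true_eq]
      exact hZ k hgk c' ((hClmem c').1 hc') x hx
    have hcandAnd : candA.Nodup := (List.nodup_range).filter _
    have hAlmem : ∀ x, x ∈ Al ↔ x ∈ Av k := by
      intro x; rw [hAl, List.mem_filter, decide_eq_true_eq]; exact ⟨fun h => h.2, fun h => ⟨hAsub x h, h⟩⟩
    have hAlnd : Al.Nodup := hcandAnd.filter _
    have hAllen : Al.length = a := by rw [hAl, length_filter_mem_of_subset hcandAnd hAsub, hca]
    -- the three difference lists are duplicate-free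
    have hn1 : (diffList p Cl (0 :: Bl)).Nodup := nodup_diffList hClnd hB0nd fun c₁ hc₁ c₂ hc₂ x₁ hx₁ x₂ hx₂ h =>
      hinjY k hgk c₁ ((hClmem _).1 hc₁) c₂ ((hClmem _).1 hc₂) x₁ ((hB0l _).1 hx₁) x₂ ((hB0l _).1 hx₂) h
    have hn2 : (diffList p Cl Al).Nodup := nodup_diffList hClnd hAlnd fun c₁ hc₁ c₂ hc₂ x₁ hx₁ x₂ hx₂ h =>
      hinjZ k hgk c₁ ((hClmem _).1 hc₁) c₂ ((hClmem _).1 hc₂) x₁ ((hAlmem _).1 hx₁) x₂ ((hAlmem _).1 hx₂) h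
    have hn3 : (diffList p Al (0 :: Bl)).Nodup := nodup_diffList hAlnd hB0nd fun c₁ hc₁ c₂ hc₂ x₁ hx₁ x₂ hx₂ h =>
      hinjX k hgk c₁ ((hAlmem _).1 hc₁) c₂ ((hAlmem _).1 hc₂) x₁ ((hB0l _).1 hx₁) x₂ ((hB0l _).1 hx₂) h
    have hmem : (diffList p Cl (0 :: Bl), diffList p Cl Al) ∈ blockDiffs p z YL a b c :=
      mem_blockDiffs (List.mem_sublistsLen.2 ⟨List.filter_sublist, hCllen⟩)
        (List.mem_sublistsLen.2 ⟨List.filter_sublist, hBllen⟩) (List.mem_sublistsLen.2 ⟨List.filter_sublist, hAllen⟩) hn1 hn2 hn3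
    -- meaning of the two difference lists
    have hYmem : ∀ y, y ∈ diffList p Cl (0 :: Bl) ↔ ∃ c' ∈ Cv k, ∃ x ∈ Bv k, (c' + p - x) % p = y := by
      intro y; rw [mem_diffList]
      constructor
      · rintro ⟨c', hc', x, hx, h⟩; exact ⟨c', (hClmem _).1 hc', x, (hB0l _).1 hx, h⟩
      · rintro ⟨c', hc', x, hx, h⟩; exact ⟨c', (hClmem _).2 hc', x, (hB0l _).2 hx, h⟩
    have hZmem : ∀ t, t ∈ diffList p Cl Al ↔ ∃ c' ∈ Cv k, ∃ x ∈ Av k, (c' + p - x) % p = t := by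
      intro t; rw [mem_diffList]
      constructor
      · rintro ⟨c', hc', x, hx, h⟩; exact ⟨c', (hClmem _).1 hc', x, (hAlmem _).1 hx, h⟩
      · rintro ⟨c', hc', x, hx, h⟩; exact ⟨c', (hClmem _).2 hc', x, (hAlmem _).2 hx, h⟩
    refine ⟨_, hmem, ?_⟩
    rw [Bool.and_eq_true, Bool.and_eq_true, List.all_eq_true, List.all_eq_true]
    refine ⟨⟨fun y hy => ?_, fun t ht => ?_⟩, ?_⟩
    · rw [Bool.not_eq_true', decide_eq_false_iff_not]
      obtain ⟨c', hc', x, hx, rfl⟩ := (hYmem y).1 hy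
      exact huY k (by simp) c' hc' x hx
    · rw [Bool.not_eq_true', decide_eq_false_iff_not]
      obtain ⟨c', hc', x, hx, rfl⟩ := (hZmem t).1 ht
      exact huZ k (by simp) c' hc' x hx
    · -- the recursive call
      apply ih hndrest hgrest
      · intro k' hk' c' hc' x hx hmemY
        rw [List.mem_append] at hmemY
        rcases hmemY with h | h
        · obtain ⟨c₂, hc₂, x₂, hx₂, h₂⟩ := (hYmem _).1 h
          exact hdisjY k (by simp) k' (by simp [hk']) (fun heq => hkrest (heq ▸ hk')) c₂ hc₂ x₂ hx₂ c' hc' x hx h₂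
        · exact huY k' (by simp [hk']) c' hc' x hx h
      · intro k₁ hk₁ k₂ hk₂ hne
        exact hdisjY k₁ (by simp [hk₁]) k₂ (by simp [hk₂]) hne
      · intro y hy
        rcases hcovY y hy with h | ⟨k', hk', c', hc', x, hx, h⟩
        · exact Or.inl (List.mem_append.2 (Or.inr h))
        · rw [List.mem_cons] at hk'
          rcases hk' with rfl | hk'
          · exact Or.inl (List.mem_append.2 (Or.inl ((hYmem y).2 ⟨c', hc', x, hx, h⟩)))
          · exact Or.inr ⟨k', hk', c', hc', x, hx, h⟩
      · intro k' hk' c' hc' x hx hmemZ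
        rw [List.mem_append] at hmemZ
        rcases hmemZ with h | h
        · obtain ⟨c₂, hc₂, x₂, hx₂, h₂⟩ := (hZmem _).1 h
          exact hdisjZ k (by simp) k' (by simp [hk']) (fun heq => hkrest (heq ▸ hk')) c₂ hc₂ x₂ hx₂ c' hc' x hx h₂
        · exact huZ k' (by simp [hk']) c' hc' x hx h
      · intro k₁ hk₁ k₂ hk₂ hne
        exact hdisjZ k₁ (by simp [hk₁]) k₂ (by simp [hk₂]) hne
      · intro t ht
        rcases hcovZ t ht with h | ⟨k', hk', c', hc', x, hx, h⟩
        · exact Or.inl (List.mem_append.2 (Or.inr h))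
        · rw [List.mem_cons] at hk'
          rcases hk' with rfl | hk'
          · exact Or.inl (List.mem_append.2 (Or.inl ((hZmem t).2 ⟨c', hc', x, hx, h⟩)))
          · exact Or.inr ⟨k', hk', c', hc', x, hx, h⟩

end Sound

end Summit.MatrixMultiplication.OmegaCensus.CubeNB
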